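import Summits.HubbardSuperconductivity.HubbardSuperconductivity.Theorems.AnisotropyChordTransferFibre3FinSplitCellB

/-!
# Route `AnisotropyChord` / H0 rotor rung: FIN regime certificate at `L = 17` (SPLIT form) — kernel facts, part b

KERNEL FACTS (zero data): cell 2 of 11 at `L = 17`, `λ·2^60 ∈ [386645728926732, 1005278895209504]` (non-vacuous).  The split certificate (`…Fibre3FinSplitCellB` / `…Fibre3FinSplitCell`): per non-vacuous λ-cell
three declarations — `nOK2 17 a b ν η` (`ν ≤ lo N`, `hi N ≤ η`, `N = ‖Π⁰‖²`), `sOK 17 a b σ` (`hi S ≤ σ`, `S = Σ Π⁰·C0fn`), `combOK2 17 a b σ ν η`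
(cheap: positivity and `3bm + σD ≤ lo(bound)·m`) — so that no single `decide` exceeds the per-declaration work ceiling; vacuous cells
by `vacOK 17 a b` (numerator or `Δ` vacuity).  Literals from the prover's float mirror `scratch/fin_iv7.py`; assembled in `…Fibre3FinMHoleSeventeen`.
Prover seat `hubbard-h0-rotor-p3` g4; helper for stmt-HubbardSuperconductivity-23918 (piece A of rung 19089; `--supports`, helper class).
WHAT THIS IS NOT: nothing here proves superconductivity in the Hubbard model; kernel facts for ONE hypothesis (regime clause) of ONE
conditional reduction at one `L`. Tree imports only; no sorry, no `native_decide`.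
-/

set_option linter.dupNamespace false
set_option autoImplicit false

namespace Summit.HubbardSuperconductivity.HubbardSuperconductivity.Theorems.AnisotropyChord.Transfer.Fibre3

namespace FinCell

set_option maxHeartbeats 400000 in
/-- kernel fact: `N` literals of cell 2 at `L = 17`. [folklore] -/
theorem cell17_2n : nOK2 17 386645728926732 1005278895209504 59498028871846474022912 153539763096923607662592 = true := by
  decide +kernel

set_option maxHeartbeats 400000 in
/-- kernel fact: `S` literal of cell 2 at `L = 17`. [folklore] -/
theorem cell17_2s : sOK 17 386645728926732 1005278895209504 8741672827030302721 = true := by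
  decide +kernel

/-- kernel fact: the cheap combination of cell 2 at `L = 17`. [folklore] -/
theorem cell17_2c : combOK2 17 386645728926732 1005278895209504 8741672827030302721 59498028871846474022912 153539763096923607662592 = true := by
  decide +kernel

end FinCell

end Summit.HubbardSuperconductivity.HubbardSuperconductivity.Theorems.AnisotropyChord.Transfer.Fibre3
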